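import Summits.QuantumFields.YangMills.Theorems.UnitScaleTiltProp7CombTowerRowsOfRegPrT3
import Literature.MathematicalPhysics.QuantumFieldTheory.Balaban1983to89.B7Prop3GeneralRotated
import HarnessLib

/-!
# Route `UnitScaleTilt`, crux K1 «MinimiserStabilityRegPr» (stmt-QuantumFields-19200), route-R E′ (A′)-on-Σ, P-A2 (β), R0 ∕ REM2ᶜ — file F-βᶜ-1 «COMB TREE REM2 LETTERS»:
# **THE TWISTED TREE TRANSPORT OF A NEAR-UNIT FIELD TO SECOND ORDER, WITH ITS LINEAR PART `(R_{0,y}ℓ)(Γ)` (print's (58) «product replaced by the sum», lit `tsum`) SUBTRACTED: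
# `‖(R_{0,y}V₁)(Γ) − 1 − (R_{0,y}ℓ)(Γ)‖ ≤ |Γ|·δ + (|Γ|·s)²`** — generic `ℤᵈ`, global form and the form LOCALISED TO A BOX along tree contours

Cell `ym3-torus` (HUMAN RULING D-0037: YM₃ on the torus is ladder rung R3 — not d = 4, not a mass gap, not Clay), width seat `ym3-torus-px17` (gen 4); ★★OWNER RULINGS №19 (3) ∕ №20 (1)
(REM2ᶜ ⟸ `hMcomb₂`; (R0) ⟸ Φᶜ + Φˢ + REM2ˢ + REM2ᶜ, ✓px13 `Prop7R0OfFrameRows`); the `ℤᵈ`∕`tHol` twin of ✓`Prop7HolRatioPerStep.norm_holRatio_sub_covWalkSum_le_two_mul_sq` + ✓px13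
`Prop7StairRem2Row.norm_stairRatio_sub_one_sub_lin_le`, feeding F-αᶜ's (`Prop7CombFrameRem2Step.combFrameRem2_step_le`) displayed tree-ratio remainder row `hSR`.
`--supports stmt-QuantumFields-19200 --as helper`; THEOREMS ONLY (0 `def`, 0 `sorry`); count-neutral.  Nothing of REM2ᶜ's currency, `hMcomb`, `hMcomb₂`, (β), `hPA2`, `hcoS`, E′, EX, the crux,
d = 4 or the gap is claimed.

THE PRINT.  [Balaban1985Averaging] (58)–(60) p. 27 (the twisted transport `(R_{0,y}V₁)(Γ) = Π R(V₀(Γ_{y,b₋}))V₁(b)`), p. 28 after (61) («R_{0,c₋}A is defined as R_{0,c₋}V′, only the product over b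
is replaced by the sum» — lit ✓`B7Prop3GeneralRotated.tsum`, proved there to be the derivative of the transport, ✓`hasDerivAt_tHol_expCfg`), Prop. 3 (122)–(123) p. 36 (first order with a quadratic
remainder), p. 24 (locality: tree contours stay in the block).

WHAT IS PROVED (ns `…Theorems.Prop7CombTreeRem2Letters`; `𝔸` any complete normed ℂ-algebra with `‖1‖ = 1`; `V₀` bi-contractive throughout).
* §1 LOCALITY OF THE LINEAR PART along non-negative tree contours: `tsum_seg_congr`, `tsum_flatMap_seg_congr`, ★`tsum_treeWord_congr` — two bond functions agreeing on the bonds of a box give the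
  same `(R_{0,p}ℓ)(Γ_{p,p+v})` for `p, p + v` in the box, `v ≥ 0` (the companion of lit ✓`B7Prop1Local.hol_treeWord_congr` ∕ ✓`B7LocalityGeneral.tHol_treeWord_congr`).
* §2 ★★ `norm_tHol_sub_one_sub_tsum_le` — GLOBAL: `‖V₁(b) − 1‖, ‖V₁(b)⁻¹ − 1‖ ≤ s` and `‖V₁(b) − 1 − ℓ(b)‖ ≤ δ` on EVERY bond ⟹ for every word `Γ` with `|Γ|·s ≤ 1`,
  `‖(R_{0,y}V₁)(Γ) − 1 − (R_{0,y}ℓ)(Γ)‖ ≤ |Γ|·δ + (|Γ|·s)²` (induction on the word: forward letter `(1+Y)·R(g)T′ − 1 − ℓ − R(g)S′ = (Y − ℓ) + R(g)(T′ − 1 − S′) + Y·(R(g)T′ − 1)`; backward letter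
  the same conjugated, plus `V₁⁻¹ − 1 + Y = V₁⁻¹Y²`; first-order factor by lit ✓`B7Prop7OneStep.norm_tHol_sub_one_le_general`).
* §3 ★★★ `norm_tHol_treeWord_sub_one_sub_tsum_le_of_box` — LOCALISED: the same for the tree contour `Γ_{p,p+v}` (`v ≥ 0`) inside a box, under the bond rows ON THE BOX only (replace `V₁` by
  `1` and `ℓ` by `0` off the box; §1 + lit ✓`tHol_treeWord_congr`).
HONEST SCOPE.  Algebra + induction over lit's transport letters; no smallness produced; the member reading (box = block of a coarse site, `s² ≤` box mass, `δ =` box `ℓ¹` remainder) is F-βᶜ-2.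

References: T. Bałaban, CMP **98** (1985) 17–51 [Balaban1985Averaging] ((9) p.18, (19) p.21, (58)–(61) pp.27–28, Prop. 3 (122)–(123) p.36, p.24).
-/

set_option autoImplicit false

noncomputable section

open scoped BigOperators

namespace Summit.QuantumFields.YangMills.Theorems.Prop7CombTreeRem2Letters

open NormedSpace
open Literature.MathematicalPhysics.QuantumFieldTheory.Balaban1983to89
open B7Prop1Explicit renaming Site → LSite
open B7Prop1Explicit (Letter e hol hol_cons disp disp_cons treeWord seg seg_natCast stepHol stepHol_true stepHol_false U1 mem_U1 norm_inv_sub_one_le)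
open B7Prop1Local (InBox inBox_add_e add_zsmul_e_apply)
open B7Prop2Explicit (hol_mem_of)
open B7Eq92Concrete (tHol)
open B7Eq78Linearization (conjR conjR_apply conjR_sub conjR_one)
open B7Prop3GeneralRotated renaming tsum → covTsum
open B7Prop3GeneralRotated (tstep tsum_cons tsum_nil tsum_append norm_conjR_le)
open B7Prop3GeneralAnalytic (tHol_cons)
open B7LocalityGeneral (tHol_treeWord_congr)
open B7Prop7OneStep (norm_tHol_sub_one_le_general)
open Summit.QuantumFields.YangMills.Theorems.Prop7CombTowerRowsOfRegPr (one_add_pow_sub_one_le_two_mul)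

variable {d : ℕ} {𝔸 : Type*} [NormedRing 𝔸] [NormedAlgebra ℂ 𝔸] [CompleteSpace 𝔸]

/-! ## §1 Locality of the linear part `(R_{0,p}ℓ)(Γ)` along non-negative tree contours -/

section Locality

variable {lo hi : LSite d} (V₀ : LSite d → Fin d → 𝔸ˣ) {A A' : LSite d → Fin d → 𝔸}

omit [NormedAlgebra ℂ 𝔸] [CompleteSpace 𝔸] in
/-- the linear transport along a straight positive segment inside the box depends only on the box bonds of `ℓ`. [cite: Balaban1985Averaging, (58) p.27, p.28, p.24] -/
theorem tsum_seg_congr (h : ∀ x κ, InBox lo hi x → InBox lo hi (x + e κ) → A x κ = A' x κ) (κ : Fin d) :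
    ∀ (n : ℕ) (p : LSite d), InBox lo hi p → InBox lo hi (p + (n : ℤ) • e κ) →
      covTsum V₀ A p (seg κ n) = covTsum V₀ A' p (seg κ n)
  | 0, p, _, _ => by simp
  | n + 1, p, hp, hpn => by
    have hpe : InBox lo hi (p + e κ) := inBox_add_e hp hpn
    have hpn' : InBox lo hi (p + e κ + (n : ℤ) • e κ) := by
      have he : p + e κ + (n : ℤ) • e κ = p + ((n + 1 : ℕ) : ℤ) • e κ := by
        push_cast; rw [add_smul, one_smul]; abel
      rw [he]; exact hpn
    rw [seg_natCast, List.replicate_succ, tsum_cons, tsum_cons]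
    simp only [tstep, ↓reduceIte, Letter.vec_true]
    rw [h p κ hp hpe, ← seg_natCast, tsum_seg_congr h κ n (p + e κ) hpe hpn']

omit [NormedAlgebra ℂ 𝔸] [CompleteSpace 𝔸] in
/-- the linear transport along a broken line of non-negative segments, changing the coordinates listed in `s` one at a time. [cite: Balaban1985Averaging, (58) p.27, p.24] -/
theorem tsum_flatMap_seg_congr (h : ∀ x κ, InBox lo hi x → InBox lo hi (x + e κ) → A x κ = A' x κ) (v : LSite d) (hv : ∀ κ, 0 ≤ v κ) :
    ∀ (s : List (Fin d)), s.Nodup → ∀ p : LSite d, InBox lo hi p →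
      (∀ κ ∈ s, lo κ ≤ p κ + v κ ∧ p κ + v κ ≤ hi κ) →
      covTsum V₀ A p (s.flatMap fun κ => seg κ (v κ)) = covTsum V₀ A' p (s.flatMap fun κ => seg κ (v κ))
  | [], _, p, _, _ => by simp
  | κ :: s, hnd, p, hp, hvs => by
    obtain ⟨hκs, hs⟩ := List.nodup_cons.mp hnd
    rw [List.flatMap_cons, tsum_append, tsum_append, B7Prop1Explicit.disp_seg]
    have hκ := hvs κ (by simp)
    have hpκ : InBox lo hi (p + v κ • e κ) := fun i => by
      rw [add_zsmul_e_apply]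
      by_cases hi : i = κ
      · subst hi; simpa using hκ
      · simpa [hi] using hp i
    have hnat : v κ = ((v κ).toNat : ℤ) := (Int.toNat_of_nonneg (hv κ)).symm
    have hseg : covTsum V₀ A p (seg κ (v κ)) = covTsum V₀ A' p (seg κ (v κ)) := by
      rw [hnat]
      exact tsum_seg_congr V₀ h κ (v κ).toNat p hp (by rw [← hnat]; exact hpκ)
    rw [hseg, tsum_flatMap_seg_congr h v hv s hs (p + v κ • e κ) hpκ ?_]
    intro κ' hκ'
    have hne : κ' ≠ κ := fun h' => hκs (h' ▸ hκ')
    rw [add_zsmul_e_apply, if_neg hne, add_zero]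
    exact hvs κ' (by simp [hκ'])

omit [NormedAlgebra ℂ 𝔸] [CompleteSpace 𝔸] in
/-- ★ **LOCALITY OF THE LINEAR PART along the tree contour `Γ_{p, p+v}` (`v ≥ 0`) inside a box containing `p` and `p + v`**: two bond functions agreeing on the box bonds give the same
`(R_{0,p}ℓ)(Γ_{p,p+v})` (the background is untouched). [cite: Balaban1985Averaging, (58) p.27, p.28, p.24] -/
theorem tsum_treeWord_congr (h : ∀ x κ, InBox lo hi x → InBox lo hi (x + e κ) → A x κ = A' x κ) (p v : LSite d) (hv : ∀ κ, 0 ≤ v κ)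
    (hp : InBox lo hi p) (hpv : InBox lo hi (p + v)) : covTsum V₀ A p (treeWord v) = covTsum V₀ A' p (treeWord v) :=
  tsum_flatMap_seg_congr V₀ h v hv _ (List.nodup_reverse.mpr (List.nodup_finRange d)) p hp fun κ _ => by simpa using hpv κ

end Locality

/-! ## §2 The twisted transport to second order, global form -/

section Global

variable [NormOneClass 𝔸]

omit [NormedAlgebra ℂ 𝔸] [CompleteSpace 𝔸] in
/-- `(1 + s)ⁿ − 1 ≤ 2ns` for `0 ≤ s`, `ns ≤ 1` (`1 + s ≤ eˢ`, `eˣ − 1 ≤ 2x` on `[0, 1]`). [folklore] -/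
theorem one_add_pow_sub_one_le_two_mul' {s : ℝ} (hs : 0 ≤ s) (n : ℕ) (hn : (n : ℝ) * s ≤ 1) : (1 + s) ^ n - 1 ≤ 2 * ((n : ℝ) * s) := by
  have h1 : (1 + s) ^ n ≤ Real.exp ((n : ℝ) * s) := by
    rw [Real.exp_nat_mul]
    exact pow_le_pow_left₀ (by positivity) (by linarith [Real.add_one_le_exp s]) n
  have hx0 : 0 ≤ (n : ℝ) * s := by positivity
  have h2 := Real.abs_exp_sub_one_le (x := (n : ℝ) * s) (by rw [abs_of_nonneg hx0]; exact hn)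
  rw [abs_of_nonneg hx0] at h2
  linarith [le_abs_self (Real.exp ((n : ℝ) * s) - 1)]

omit [NormedAlgebra ℂ 𝔸] [CompleteSpace 𝔸] in
/-- ONE LETTER OF THE SECOND-ORDER INDUCTION (both signs): with `T′ = (R_{0,y+l}V₁)(Γ′)`, `S′ = (R_{0,y+l}ℓ)(Γ′)`, `g` the background step transport,
`‖(R_{0,y}V₁)(lΓ′) − 1 − (R_{0,y}ℓ)(lΓ′)‖ ≤ δ + s² + ‖T′ − 1 − S′‖ + s·‖T′ − 1‖` — forward letter: `(1+Y)R(g)T′ − 1 − ℓ − R(g)S′ = (Y − ℓ) + R(g)(T′ − 1 − S′) + Y·(R(g)T′ − 1)`; backward letter: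
`R(g)(V₁⁻¹T′) − 1 + R(g)ℓ − R(g)S′ = R(g)[(V₁⁻¹ − 1 + Y) − (Y − ℓ) + (T′ − 1 − S′) + (V₁⁻¹ − 1)(T′ − 1)]`, `V₁⁻¹ − 1 + Y = V₁⁻¹Y²`. [cite: Balaban1985Averaging, (58)-(60) p.27, p.28, (9) p.18] -/
theorem norm_tHol_cons_sub_one_sub_tsum_le {V₀ V₁ : LSite d → Fin d → 𝔸ˣ} (hV₀ : ∀ x κ, V₀ x κ ∈ U1 𝔸) (hV₁U : ∀ x κ, V₁ x κ ∈ U1 𝔸) {s δ : ℝ} (hs : 0 ≤ s)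
    (hV₁ : ∀ x κ, ‖((V₁ x κ : 𝔸ˣ) : 𝔸) - 1‖ ≤ s) (ℓ : LSite d → Fin d → 𝔸) (hℓ : ∀ x κ, ‖((V₁ x κ : 𝔸ˣ) : 𝔸) - 1 - ℓ x κ‖ ≤ δ)
    (l : Letter d) (w : List (Letter d)) (y : LSite d) :
    ‖((tHol V₀ V₁ y (l :: w) : 𝔸ˣ) : 𝔸) - 1 - covTsum V₀ ℓ y (l :: w)‖
      ≤ δ + s ^ 2 + ‖((tHol V₀ V₁ (y + l.vec) w : 𝔸ˣ) : 𝔸) - 1 - covTsum V₀ ℓ (y + l.vec) w‖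
        + s * ‖((tHol V₀ V₁ (y + l.vec) w : 𝔸ˣ) : 𝔸) - 1‖ := by
  set T' : 𝔸 := ((tHol V₀ V₁ (y + l.vec) w : 𝔸ˣ) : 𝔸) with hT'
  set S' : 𝔸 := covTsum V₀ ℓ (y + l.vec) w with hS'
  set g : 𝔸ˣ := stepHol V₀ y l with hg
  have hgU : g ∈ U1 𝔸 := B7Prop1Explicit.stepHol_mem hV₀ y l
  have hconj : ∀ X : 𝔸, ‖conjR g X‖ ≤ ‖X‖ := fun X => norm_conjR_le hgU X
  have hRgS : conjR g T' - 1 - conjR g S' = conjR g (T' - 1 - S') := by rw [conjR_sub, conjR_sub, conjR_one]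
  have hRg1 : conjR g T' - 1 = conjR g (T' - 1) := by rw [conjR_sub, conjR_one]
  have hδ0 : 0 ≤ δ := (norm_nonneg _).trans (hℓ y l.1)
  rw [tHol_cons, tsum_cons, ← hg]
  rcases l with ⟨μ, _ | _⟩
  · -- backward letter `b = ⟨y − e_μ, y⟩`: `g = V₀(b)⁻¹`, `(V₁V₀)(l) = V₀(b)⁻¹V₁(b)⁻¹ = g·V₁(b)⁻¹`
    set Vb : 𝔸ˣ := V₁ (y + Letter.vec ((μ, false) : Letter d)) μ with hVb
    have hstepV : stepHol (V₁ * V₀) y (μ, false) = g * Vb⁻¹ := by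
      rw [hg, hVb]; simp only [stepHol, Bool.false_eq_true, ↓reduceIte, Pi.mul_apply, mul_inv_rev]
    have hstepℓ : tstep V₀ ℓ y (μ, false) = -conjR g (ℓ (y + Letter.vec ((μ, false) : Letter d)) μ) := by
      rw [hg]; simp only [tstep, Bool.false_eq_true, ↓reduceIte]
    rw [hstepV, hstepℓ]
    set ℓb : 𝔸 := ℓ (y + Letter.vec ((μ, false) : Letter d)) μ with hℓb
    -- the value is `R(g)(V₁(b)⁻¹·T′)`
    have hval : (((g * Vb⁻¹ : 𝔸ˣ) * tHol V₀ V₁ (y + Letter.vec ((μ, false) : Letter d)) w * g⁻¹ : 𝔸ˣ) : 𝔸) = conjR g (((Vb⁻¹ : 𝔸ˣ) : 𝔸) * T') := by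
      rw [conjR_apply, Units.val_mul, Units.val_mul, Units.val_mul, hT']; noncomm_ring
    rw [hval]
    have e1 : conjR g (((Vb⁻¹ : 𝔸ˣ) : 𝔸) * T') - 1 - (-conjR g ℓb + conjR g S')
        = conjR g (((((Vb⁻¹ : 𝔸ˣ) : 𝔸) - 1 + ((Vb : 𝔸) - 1)) - (((Vb : 𝔸) - 1) - ℓb)) + ((T' - 1 - S') + (((Vb⁻¹ : 𝔸ˣ) : 𝔸) - 1) * (T' - 1))) := by
      rw [show conjR g (((Vb⁻¹ : 𝔸ˣ) : 𝔸) * T') - 1 - (-conjR g ℓb + conjR g S') = conjR g (((Vb⁻¹ : 𝔸ˣ) : 𝔸) * T' - 1 + ℓb - S') by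
        rw [conjR_sub, B7Eq78Linearization.conjR_add, conjR_sub, conjR_one]; abel]
      congr 1; noncomm_ring
    have e2 : ((Vb⁻¹ : 𝔸ˣ) : 𝔸) - 1 + ((Vb : 𝔸) - 1) = ((Vb⁻¹ : 𝔸ˣ) : 𝔸) * (((Vb : 𝔸) - 1) * ((Vb : 𝔸) - 1)) := by
      have hi : ((Vb⁻¹ : 𝔸ˣ) : 𝔸) * (Vb : 𝔸) = 1 := Units.inv_mul Vb
      have : ((Vb⁻¹ : 𝔸ˣ) : 𝔸) * (((Vb : 𝔸) - 1) * ((Vb : 𝔸) - 1))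
          = ((Vb⁻¹ : 𝔸ˣ) : 𝔸) * (Vb : 𝔸) * (Vb : 𝔸) - 2 * (((Vb⁻¹ : 𝔸ˣ) : 𝔸) * (Vb : 𝔸)) + ((Vb⁻¹ : 𝔸ˣ) : 𝔸) := by noncomm_ring
      rw [this, hi]; noncomm_ring
    rw [e1]
    refine (hconj _).trans ?_
    have hb2 : ‖((Vb⁻¹ : 𝔸ˣ) : 𝔸) - 1 + ((Vb : 𝔸) - 1)‖ ≤ s ^ 2 := by
      rw [e2]
      refine (norm_mul_le _ _).trans ?_
      have h1 : ‖((Vb⁻¹ : 𝔸ˣ) : 𝔸)‖ ≤ 1 := (hV₁U _ μ).2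
      have h2 : ‖((Vb : 𝔸) - 1) * ((Vb : 𝔸) - 1)‖ ≤ s * s := (norm_mul_le _ _).trans (mul_le_mul (hV₁ _ μ) (hV₁ _ μ) (norm_nonneg _) hs)
      nlinarith [norm_nonneg (((Vb : 𝔸) - 1) * ((Vb : 𝔸) - 1)), norm_nonneg ((Vb⁻¹ : 𝔸ˣ) : 𝔸)]
    have hbδ : ‖((Vb : 𝔸) - 1) - ℓb‖ ≤ δ := hℓ _ μ
    have hcross : ‖(((Vb⁻¹ : 𝔸ˣ) : 𝔸) - 1) * (T' - 1)‖ ≤ s * ‖T' - 1‖ :=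
      (norm_mul_le _ _).trans (mul_le_mul_of_nonneg_right ((norm_inv_sub_one_le (hV₁U _ μ)).trans (hV₁ _ μ)) (norm_nonneg _))
    calc ‖((((Vb⁻¹ : 𝔸ˣ) : 𝔸) - 1 + ((Vb : 𝔸) - 1)) - (((Vb : 𝔸) - 1) - ℓb)) + ((T' - 1 - S') + (((Vb⁻¹ : 𝔸ˣ) : 𝔸) - 1) * (T' - 1))‖
        ≤ (‖((Vb⁻¹ : 𝔸ˣ) : 𝔸) - 1 + ((Vb : 𝔸) - 1)‖ + ‖((Vb : 𝔸) - 1) - ℓb‖) + (‖T' - 1 - S'‖ + ‖(((Vb⁻¹ : 𝔸ˣ) : 𝔸) - 1) * (T' - 1)‖) :=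
          (norm_add_le _ _).trans (add_le_add (norm_sub_le _ _) (norm_add_le _ _))
      _ ≤ (s ^ 2 + δ) + (‖T' - 1 - S'‖ + s * ‖T' - 1‖) := by gcongr
      _ = _ := by ring
  · -- forward letter `b = ⟨y, y + e_μ⟩`: `g = V₀(b)`, `(V₁V₀)(l) = V₁(b)·g`
    set Vb : 𝔸ˣ := V₁ y μ with hVb
    have hstepV : stepHol (V₁ * V₀) y (μ, true) = Vb * g := by
      rw [hg, hVb]; simp only [stepHol, ↓reduceIte, Pi.mul_apply]
    have hstepℓ : tstep V₀ ℓ y (μ, true) = ℓ y μ := by simp only [tstep, ↓reduceIte]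
    rw [hstepV, hstepℓ]
    have hval : (((Vb * g : 𝔸ˣ) * tHol V₀ V₁ (y + Letter.vec ((μ, true) : Letter d)) w * g⁻¹ : 𝔸ˣ) : 𝔸) = (Vb : 𝔸) * conjR g T' := by
      rw [conjR_apply, Units.val_mul, Units.val_mul, Units.val_mul, hT']; noncomm_ring
    rw [hval]
    have e1 : (Vb : 𝔸) * conjR g T' - 1 - (ℓ y μ + conjR g S')
        = ((Vb : 𝔸) - 1 - ℓ y μ) + ((conjR g T' - 1 - conjR g S') + ((Vb : 𝔸) - 1) * (conjR g T' - 1)) := by noncomm_ring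
    rw [e1, hRgS, hRg1]
    have hcross : ‖((Vb : 𝔸) - 1) * conjR g (T' - 1)‖ ≤ s * ‖T' - 1‖ :=
      (norm_mul_le _ _).trans (mul_le_mul (hV₁ y μ) (hconj _) (norm_nonneg _) hs)
    calc ‖((Vb : 𝔸) - 1 - ℓ y μ) + (conjR g (T' - 1 - S') + ((Vb : 𝔸) - 1) * conjR g (T' - 1))‖
        ≤ ‖(Vb : 𝔸) - 1 - ℓ y μ‖ + (‖conjR g (T' - 1 - S')‖ + ‖((Vb : 𝔸) - 1) * conjR g (T' - 1)‖) :=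
          (norm_add_le _ _).trans (add_le_add le_rfl (norm_add_le _ _))
      _ ≤ δ + (‖T' - 1 - S'‖ + s * ‖T' - 1‖) := add_le_add (hℓ y μ) (add_le_add (hconj _) hcross)
      _ ≤ _ := by nlinarith [sq_nonneg s]

omit [NormedAlgebra ℂ 𝔸] [CompleteSpace 𝔸] in
/-- ★★ **THE TWISTED TRANSPORT TO SECOND ORDER, GLOBAL FORM**: `V₀` bi-contractive; `V₁` bi-contractive with `V₁(b)` within `s` of `1` and `‖V₁(b) − 1 − ℓ(b)‖ ≤ δ` on every bond ⟹ for every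
word `Γ` from `y` with `|Γ|·s ≤ 1`: `‖(R_{0,y}V₁)(Γ) − 1 − (R_{0,y}ℓ)(Γ)‖ ≤ |Γ|·δ + (|Γ|·s)²` (induction on the word with the one-letter step; the first-order factor `‖(R_{0,·}V₁)(Γ′) − 1‖ ≤ 2|Γ′|s`
by lit ✓`B7Prop7OneStep.norm_tHol_sub_one_le_general`). [cite: Balaban1985Averaging, (58)-(60) p.27, p.28, Prop. 3 (122)-(123) p.36, (19) p.21] -/
theorem norm_tHol_sub_one_sub_tsum_le {V₀ V₁ : LSite d → Fin d → 𝔸ˣ} (hV₀ : ∀ x κ, V₀ x κ ∈ U1 𝔸) (hV₁U : ∀ x κ, V₁ x κ ∈ U1 𝔸) {s δ : ℝ} (hs : 0 ≤ s)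
    (hV₁ : ∀ x κ, ‖((V₁ x κ : 𝔸ˣ) : 𝔸) - 1‖ ≤ s) (ℓ : LSite d → Fin d → 𝔸) (hℓ : ∀ x κ, ‖((V₁ x κ : 𝔸ˣ) : 𝔸) - 1 - ℓ x κ‖ ≤ δ) :
    ∀ (w : List (Letter d)) (y : LSite d), (w.length : ℝ) * s ≤ 1 →
      ‖((tHol V₀ V₁ y w : 𝔸ˣ) : 𝔸) - 1 - covTsum V₀ ℓ y w‖ ≤ (w.length : ℝ) * δ + ((w.length : ℝ) * s) ^ 2
  | [], y, _ => by simp [tHol]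
  | l :: w, y, hws => by
    have hlen : ((l :: w).length : ℝ) = (w.length : ℝ) + 1 := by rw [List.length_cons]; push_cast; ring
    have hw0 : (0 : ℝ) ≤ w.length := Nat.cast_nonneg _
    have hws' : (w.length : ℝ) * s ≤ 1 := by rw [hlen] at hws; nlinarith
    have ih := norm_tHol_sub_one_sub_tsum_le hV₀ hV₁U hs hV₁ ℓ hℓ w (y + l.vec) hws'
    -- the first-order factor
    have hV₁' : ∀ x κ, ‖((V₁ x κ : 𝔸ˣ) : 𝔸) - 1‖ ≤ s ∧ ‖(((V₁ x κ)⁻¹ : 𝔸ˣ) : 𝔸) - 1‖ ≤ s := fun x κ =>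
      ⟨hV₁ x κ, (norm_inv_sub_one_le (hV₁U x κ)).trans (hV₁ x κ)⟩
    have hW : ∀ x κ, ‖((V₀ x κ : 𝔸ˣ) : 𝔸)‖ ≤ (1 : ℝ) ∧ ‖(((V₀ x κ)⁻¹ : 𝔸ˣ) : 𝔸)‖ ≤ (1 : ℝ) := fun x κ => hV₀ x κ
    have hF : ‖((tHol V₀ V₁ (y + l.vec) w : 𝔸ˣ) : 𝔸) - 1‖ ≤ 2 * ((w.length : ℝ) * s) := by
      have h := norm_tHol_sub_one_le_general (le_refl (1 : ℝ)) hs hW hV₁' w (y + l.vec)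
      rw [one_pow, one_mul] at h
      exact h.trans (one_add_pow_sub_one_le_two_mul' hs _ hws')
    have hstep := norm_tHol_cons_sub_one_sub_tsum_le hV₀ hV₁U hs hV₁ ℓ hℓ l w y
    rw [hlen]
    have hsF : s * ‖((tHol V₀ V₁ (y + l.vec) w : 𝔸ˣ) : 𝔸) - 1‖ ≤ s * (2 * ((w.length : ℝ) * s)) := mul_le_mul_of_nonneg_left hF hs
    nlinarith [hstep, ih, hsF, sq_nonneg s]

end Global

/-! ## §3 The twisted transport to second order along a tree contour, LOCALISED to a box -/

section Local

variable [NormOneClass 𝔸]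

omit [NormedAlgebra ℂ 𝔸] [CompleteSpace 𝔸] in
/-- ★★★ **THE TWISTED TREE TRANSPORT TO SECOND ORDER, LOCALISED**: `V₀` bi-contractive; on the bonds WITH BOTH END POINTS IN THE BOX `[lo, hi]`, `V₁(b)` bi-contractive within `s` of `1` and
`‖V₁(b) − 1 − ℓ(b)‖ ≤ δ`; then for the tree contour `Γ_{p,p+v}` (`v ≥ 0`, `p`, `p + v` in the box) with `|Γ|·s ≤ 1`:
`‖(R_{0,p}V₁)(Γ_{p,p+v}) − 1 − (R_{0,p}ℓ)(Γ_{p,p+v})‖ ≤ |Γ|·δ + (|Γ|·s)²` (replace `V₁` by `1` and `ℓ` by `0` off the box: lit ✓`tHol_treeWord_congr` + §1 ✓`tsum_treeWord_congr`, then §2).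
[cite: Balaban1985Averaging, (58)-(60) p.27, p.28, p.24, Prop. 3 (122)-(123) p.36] -/
theorem norm_tHol_treeWord_sub_one_sub_tsum_le_of_box (V₀ V₁ : LSite d → Fin d → 𝔸ˣ) (hV₀ : ∀ x κ, V₀ x κ ∈ U1 𝔸)
    {lo hi : LSite d} {s δ : ℝ} (hs : 0 ≤ s) (hδ : 0 ≤ δ)
    (hV₁ : ∀ x κ, InBox lo hi x → InBox lo hi (x + e κ) → V₁ x κ ∈ U1 𝔸 ∧ ‖((V₁ x κ : 𝔸ˣ) : 𝔸) - 1‖ ≤ s)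
    (ℓ : LSite d → Fin d → 𝔸) (hℓ : ∀ x κ, InBox lo hi x → InBox lo hi (x + e κ) → ‖((V₁ x κ : 𝔸ˣ) : 𝔸) - 1 - ℓ x κ‖ ≤ δ)
    (p v : LSite d) (hv : ∀ κ, 0 ≤ v κ) (hp : InBox lo hi p) (hpv : InBox lo hi (p + v)) (hn : ((treeWord v).length : ℝ) * s ≤ 1) :
    ‖((tHol V₀ V₁ p (treeWord v) : 𝔸ˣ) : 𝔸) - 1 - covTsum V₀ ℓ p (treeWord v)‖
      ≤ ((treeWord v).length : ℝ) * δ + (((treeWord v).length : ℝ) * s) ^ 2 := by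
  classical
  -- the field and the linear part localised to the box
  set V₁' : LSite d → Fin d → 𝔸ˣ := fun x κ => if InBox lo hi x ∧ InBox lo hi (x + e κ) then V₁ x κ else 1 with hV₁'
  set ℓ' : LSite d → Fin d → 𝔸 := fun x κ => if InBox lo hi x ∧ InBox lo hi (x + e κ) then ℓ x κ else 0 with hℓ'
  have hagree : B7Prop1Local.AgreeOn lo hi V₁ V₁' := by
    intro x κ hx hxe
    rw [hV₁']; dsimp only; rw [if_pos ⟨hx, hxe⟩]
  have hagree₀ : B7Prop1Local.AgreeOn lo hi V₀ V₀ := fun _ _ _ _ => rfl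
  have hagreeℓ : ∀ x κ, InBox lo hi x → InBox lo hi (x + e κ) → ℓ x κ = ℓ' x κ := by
    intro x κ hx hxe
    rw [hℓ']; dsimp only; rw [if_pos ⟨hx, hxe⟩]
  rw [tHol_treeWord_congr hagree₀ hagree p v hp hpv, tsum_treeWord_congr V₀ hagreeℓ p v hv hp hpv]
  -- the global rows for the localised objects
  have hU' : ∀ x κ, V₁' x κ ∈ U1 𝔸 := by
    intro x κ
    rw [hV₁']; dsimp only
    by_cases hb : InBox lo hi x ∧ InBox lo hi (x + e κ)
    · rw [if_pos hb]; exact (hV₁ x κ hb.1 hb.2).1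
    · rw [if_neg hb]; exact (U1 𝔸).one_mem
  have hs' : ∀ x κ, ‖((V₁' x κ : 𝔸ˣ) : 𝔸) - 1‖ ≤ s := by
    intro x κ
    rw [hV₁']; dsimp only
    by_cases hb : InBox lo hi x ∧ InBox lo hi (x + e κ)
    · rw [if_pos hb]; exact (hV₁ x κ hb.1 hb.2).2
    · rw [if_neg hb]; simp [hs]
  have hℓ'' : ∀ x κ, ‖((V₁' x κ : 𝔸ˣ) : 𝔸) - 1 - ℓ' x κ‖ ≤ δ := by
    intro x κ
    rw [hV₁', hℓ']; dsimp only
    by_cases hb : InBox lo hi x ∧ InBox lo hi (x + e κ)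
    · rw [if_pos hb, if_pos hb]; exact hℓ x κ hb.1 hb.2
    · rw [if_neg hb, if_neg hb]; simp [hδ]
  exact norm_tHol_sub_one_sub_tsum_le hV₀ hU' hs hs' ℓ' hℓ'' (treeWord v) p hn

end Local

end Summit.QuantumFields.YangMills.Theorems.Prop7CombTreeRem2Letters

end
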